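import Literature.NumberTheory.Sieve.BombieriFriedlanderIwaniecTheorem9Errors
import Literature.NumberTheory.Sieve.BombieriFriedlanderIwaniecInterior
import HarnessLib

/-!
# Bombieri–Friedlander–Iwaniec 1986, §16 for Theorem 9: Case II — Theorem 7* on the corners

Topic `Literature/NumberTheory/Sieve`, sibling of
`Literature.NumberTheory.Sieve.BombieriFriedlanderIwaniecTheorem9Proofs`.  Everything here is
PROVED (the named facts `BombieriFriedlanderIwaniecTheorem7Star` and `BombieriFriedlanderIwaniecLemma3`
enter as hypotheses); no named fact is introduced.

BFI, Acta Math. 156 (1986), §16 p. 250: if the exponents (15.6) of a Heath-Brown piece have no partial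
sum in the range (16.1), they split as `ν₁ + … + ν_k + τ = 1`, `ν_i ≥ (1−θ₂)/3 − ε`, `τ ≤ θ₂ + ε`,
`1 ≤ k ≤ 3`, and "we now apply Theorem 7* with `M = x^{ν₁}` and `N = x^{ν₂}` (in case `k = 1` we take
`M = x^{ν₁}` and `N = 1`)".  This file supplies that application for a triple piece `c ⋆ g₁ ⋆ g₂`
(`g₁, g₂` sieved box indicators of the two large variables, `c` the cofactor):

* `BFI.sum_mul_conv_eq_sum_sum`, `BFI.sum_mul_conv3_eq_sum_sum_sum` — weighted expansions of Dirichlet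
  convolutions over finite supports;
* `BFI.sievedDisc_conv3_eq`, `BFI.sum_sievedDisc_conv3_eq_sum_setQSum` — the piece against one modulus,
  and against the `q`-sum of Theorem 9, in terms of the brackets `setCongrCount − setCoprimeCount/φ`
  and their `q`-sums `BFI.setQSum` (the sums `Δ*` of §14, `…Theorem7StarBlocks`);
* `BFI.caseII_reduction` — `2|c_l||s| ≤ η c_l²|s| + η⁻¹|s|`: the pair sum is at most
  `(η/2) T₁ + (2η)⁻¹ Δ*_sets` (this replaces the supremum bound for the coefficients `c_l` on
  `z₀`-rough integers of the print, so that the sifting level `z = exp(√log x)` of the tree suffices);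
* `BFI.caseII_T1_le`, `BFI.sum_triples_le_sum_fiber` — the trivial majorant `T₁` against
  `∑ τ(k)^{28} τ(k−a)² + Φ₂ ∑ τ(k)^{28}` (each `k = lmn` has `≤ τ(k)²` factorisations);
* `BFI.caseII_bound` — Case II reduced to divisor moments and a uniform bound at the corners of the
  boxes (`BFI.deltaStarSets_Ioc_le`);
* `BFI.caseII_corners` — **Theorem 7*** at the corners: (14.5) `LR < x'^{1/2−e}`, (14.6)
  `L^{1/2}R < Mx'^{−e}` from `ℓ + θ < 1/2 − e₀`, `ℓ/2 + θ < ν₁ − e₀`, level `QR < xℒ^{−B}`, sifting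
  level `exp(√log x) ≤ z₀(x')`.

## References

* E. Bombieri, J. B. Friedlander, H. Iwaniec, *Primes in arithmetic progressions to large moduli*,
  Acta Math. 156 (1986), 203–251: §1 Theorem 9 p. 209; §2 Lemma 3 p. 211; §14 pp. 244–246;
  §15 pp. 244–246; §16 p. 250. [BombieriFriedlanderIwaniecActa1986]
* P. Shiu, *A Brun–Titchmarsh theorem for multiplicative functions*, J. reine angew. Math. 313
  (1980), 161–170, Theorem 1. [Shiu1980]
-/

open Finset Real
open scoped ArithmeticFunction.sigma

namespace Literature.NumberTheory.Sieve

namespace BFI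

/-! ### Weighted expansions of Dirichlet convolutions over finite supports -/

/-- **Weighted expansion of a Dirichlet convolution over finite supports.**  If `f` is supported in
`A`, `g` in `B`, and `ab ∈ K` whenever `f(a) g(b) ≠ 0`, then for any weight `h`,
`∑_{k ∈ K} h(k) (f ⋆ g)(k) = ∑_{a ∈ A} ∑_{b ∈ B} h(ab) f(a) g(b)`. [folklore] -/
theorem sum_mul_conv_eq_sum_sum (f g : ArithmeticFunction ℝ) (h : ℕ → ℝ) {K A B : Finset ℕ}
    (hA : ∀ a, f a ≠ 0 → a ∈ A) (hB : ∀ b, g b ≠ 0 → b ∈ B)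
    (hK : ∀ a b, f a ≠ 0 → g b ≠ 0 → a * b ∈ K) :
    ∑ k ∈ K, h k * (f * g) k = ∑ a ∈ A, ∑ b ∈ B, h (a * b) * (f a * g b) := by
  classical
  -- both sides as sums over pairs
  have hL : ∑ k ∈ K, h k * (f * g) k =
      ∑ s ∈ K.sigma (fun k => k.divisorsAntidiagonal), h (s.2.1 * s.2.2) * (f s.2.1 * g s.2.2) := by
    rw [Finset.sum_sigma]
    refine Finset.sum_congr rfl fun k _ => ?_
    rw [ArithmeticFunction.mul_apply, Finset.mul_sum]
    refine Finset.sum_congr rfl fun p hp => ?_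
    rw [(Nat.mem_divisorsAntidiagonal.1 hp).1]
  have hR : ∑ a ∈ A, ∑ b ∈ B, h (a * b) * (f a * g b) =
      ∑ p ∈ A ×ˢ B, h (p.1 * p.2) * (f p.1 * g p.2) := by
    rw [Finset.sum_product]
  rw [hL, hR]
  refine Finset.sum_bij_ne_zero (fun s _ _ => s.2) (fun s hs hne => ?_) (fun s₁ hs₁ hne₁ s₂ hs₂ hne₂ heq => ?_)
    (fun p hp hne => ?_) (fun s _ _ => rfl)
  · -- lands in `A × B`
    have hf : f s.2.1 ≠ 0 := fun h0 => hne (by rw [h0]; ring)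
    have hg : g s.2.2 ≠ 0 := fun h0 => hne (by rw [h0]; ring)
    exact Finset.mem_product.2 ⟨hA _ hf, hB _ hg⟩
  · -- injective
    obtain ⟨k₁, p₁⟩ := s₁
    obtain ⟨k₂, p₂⟩ := s₂
    simp only at heq
    subst heq
    have h1 := (Nat.mem_divisorsAntidiagonal.1 (Finset.mem_sigma.1 hs₁).2).1
    have h2 := (Nat.mem_divisorsAntidiagonal.1 (Finset.mem_sigma.1 hs₂).2).1
    simp only at h1 h2
    have : k₁ = k₂ := h1.symm.trans h2
    subst this
    rfl
  · -- surjective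
    have hf : f p.1 ≠ 0 := fun h0 => hne (by rw [h0]; ring)
    have hg : g p.2 ≠ 0 := fun h0 => hne (by rw [h0]; ring)
    have hp1 : p.1 ≠ 0 := fun h0 => hf (by rw [h0]; exact f.map_zero)
    have hp2 : p.2 ≠ 0 := fun h0 => hg (by rw [h0]; exact g.map_zero)
    refine ⟨⟨p.1 * p.2, p⟩, Finset.mem_sigma.2 ⟨hK _ _ hf hg, ?_⟩, hne, rfl⟩
    exact Nat.mem_divisorsAntidiagonal.2 ⟨rfl, Nat.mul_ne_zero hp1 hp2⟩

/-- The support of a Dirichlet convolution lies in the products of the supports. [folklore] -/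
theorem support_conv_subset_image (f g : ArithmeticFunction ℝ) {A B : Finset ℕ}
    (hA : ∀ a, f a ≠ 0 → a ∈ A) (hB : ∀ b, g b ≠ 0 → b ∈ B) {t : ℕ} (ht : (f * g) t ≠ 0) :
    ∃ a ∈ A, ∃ b ∈ B, a * b = t ∧ f a ≠ 0 ∧ g b ≠ 0 := by
  classical
  rw [ArithmeticFunction.mul_apply] at ht
  obtain ⟨p, hp, hne⟩ := Finset.exists_ne_zero_of_sum_ne_zero ht
  have hf : f p.1 ≠ 0 := left_ne_zero_of_mul hne
  have hg : g p.2 ≠ 0 := right_ne_zero_of_mul hne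
  exact ⟨p.1, hA _ hf, p.2, hB _ hg, (Nat.mem_divisorsAntidiagonal.1 hp).1, hf, hg⟩

/-- **Weighted expansion of a triple convolution over finite supports**: with `c, g₁, g₂` supported in
`SL, SM, SN` and `lmn ∈ K` whenever `c(l) g₁(m) g₂(n) ≠ 0`,
`∑_{k ∈ K} h(k) (c ⋆ g₁ ⋆ g₂)(k) = ∑_{l ∈ SL} ∑_{m ∈ SM} ∑_{n ∈ SN} h(lmn) c(l) g₁(m) g₂(n)`. [folklore] -/
theorem sum_mul_conv3_eq_sum_sum_sum (c g₁ g₂ : ArithmeticFunction ℝ) (h : ℕ → ℝ)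
    {K SL SM SN : Finset ℕ}
    (hSL : ∀ l, c l ≠ 0 → l ∈ SL) (hSM : ∀ m, g₁ m ≠ 0 → m ∈ SM) (hSN : ∀ n, g₂ n ≠ 0 → n ∈ SN)
    (hK : ∀ l m n, c l ≠ 0 → g₁ m ≠ 0 → g₂ n ≠ 0 → l * m * n ∈ K) :
    ∑ k ∈ K, h k * (c * g₁ * g₂) k =
      ∑ l ∈ SL, ∑ m ∈ SM, ∑ n ∈ SN, h (l * m * n) * (c l * g₁ m * g₂ n) := by
  classical
  set T : Finset ℕ := (SL ×ˢ SM).image (fun p : ℕ × ℕ => p.1 * p.2) with hT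
  have hTsupp : ∀ t, (c * g₁) t ≠ 0 → t ∈ T := by
    intro t ht
    obtain ⟨l, hl, m, hm, hlm, -, -⟩ := support_conv_subset_image c g₁ hSL hSM ht
    exact Finset.mem_image.2 ⟨(l, m), Finset.mem_product.2 ⟨hl, hm⟩, hlm⟩
  have hK' : ∀ t n, (c * g₁) t ≠ 0 → g₂ n ≠ 0 → t * n ∈ K := by
    intro t n ht hn
    obtain ⟨l, -, m, -, hlm, hl, hm⟩ := support_conv_subset_image c g₁ hSL hSM ht
    rw [← hlm]
    exact hK l m n hl hm hn
  rw [sum_mul_conv_eq_sum_sum (c * g₁) g₂ h hTsupp hSN hK']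
  -- expand the inner convolution, for each `n`
  have hinner : ∀ n : ℕ, ∑ t ∈ T, h (t * n) * ((c * g₁) t * g₂ n) =
      ∑ l ∈ SL, ∑ m ∈ SM, h (l * m * n) * (c l * g₁ m * g₂ n) := by
    intro n
    have h1 : ∑ t ∈ T, h (t * n) * ((c * g₁) t * g₂ n) =
        g₂ n * ∑ t ∈ T, (fun t => h (t * n)) t * (c * g₁) t := by
      rw [Finset.mul_sum]
      exact Finset.sum_congr rfl fun t _ => by ring
    rw [h1, sum_mul_conv_eq_sum_sum c g₁ (fun t => h (t * n)) hSL hSM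
      (fun l m hl hm => Finset.mem_image.2 ⟨(l, m), Finset.mem_product.2 ⟨hSL l hl, hSM m hm⟩, rfl⟩),
      Finset.mul_sum]
    refine Finset.sum_congr rfl fun l _ => ?_
    rw [Finset.mul_sum]
    exact Finset.sum_congr rfl fun m _ => by ring
  rw [Finset.sum_comm]
  simp_rw [hinner]
  rw [Finset.sum_comm]
  exact Finset.sum_congr rfl fun l _ => Finset.sum_comm


/-! ### The pieces of Case II as sums of the brackets of `Δ*` (BFI §14) -/

/-- If `(d, a) = 1` and `(l, d) > 1`, the congruence `lmn ≡ a (mod d)` has no solutions: the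
congruence count of §14 vanishes. [folklore] -/
theorem setCongrCount_eq_zero_of_not_coprime {a : ℤ} {d l : ℕ} (hda : IsCoprime (d : ℤ) a)
    (hl : ¬ l.Coprime d) (z : ℝ) (SM SN : Finset ℕ) : setCongrCount a z SM SN l d = 0 := by
  unfold setCongrCount
  refine Finset.sum_eq_zero fun m _ => Finset.sum_eq_zero fun n _ => ?_
  rw [if_neg]
  intro hc
  apply hl
  -- `g = gcd(l, d)` divides `d` and `a`, hence is a unit
  set g : ℕ := Nat.gcd l d with hg
  have hgd : (g : ℤ) ∣ (d : ℤ) := Int.natCast_dvd_natCast.2 (Nat.gcd_dvd_right l d)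
  have hgl : (g : ℤ) ∣ (l : ℤ) := Int.natCast_dvd_natCast.2 (Nat.gcd_dvd_left l d)
  have h1 : (((l * m * n : ℕ) : ℤ) : ZMod d) = ((a : ℤ) : ZMod d) := by
    rw [Int.cast_natCast]; exact hc
  rw [ZMod.intCast_eq_intCast_iff_dvd_sub] at h1
  -- `d ∣ a − lmn`
  have h2 : (g : ℤ) ∣ a - ((l * m * n : ℕ) : ℤ) := hgd.trans h1
  have h3 : (g : ℤ) ∣ ((l * m * n : ℕ) : ℤ) := by
    push_cast; exact (hgl.mul_right _).mul_right _
  have h4 : (g : ℤ) ∣ a := by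
    have := h2.add h3
    rwa [sub_add_cancel] at this
  have hu : IsUnit (g : ℤ) := hda.isUnit_of_dvd' hgd h4
  rw [Int.isUnit_iff_natAbs_eq, Int.natAbs_natCast] at hu
  exact hu

/-- `(lmn, d) = 1 ⟺ (l, d) = 1 ∧ (mn, d) = 1`. [folklore] -/
theorem coprime_mul3_iff (l m n d : ℕ) : (l * m * n).Coprime d ↔ l.Coprime d ∧ (m * n).Coprime d := by
  rw [mul_assoc, Nat.coprime_mul_iff_left]

/-- **A triple piece against one modulus** (BFI §16 with §14, p. 244: the sums `Δ` count
`lmn ≡ a (qr)` for rough `l, m, n` in boxes).  Let `c` be supported in `SL` on `z`-rough integers,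
`g₁ = 1_{SM} · 1_rough`, `g₂ = 1_{SN} · 1_rough`, with `lmn ∈ (x, 2x]` throughout `SL × SM × SN`.
Then for `(d, a) = 1` the sifted dyadic discrepancy of `c ⋆ g₁ ⋆ g₂` at the modulus `d` is
`∑_{l ∈ SL, (l,d)=1} c(l) · (setCongrCount(l, d) − setCoprimeCount(d)/φ(d))`.
[cite: BombieriFriedlanderIwaniecActa1986, §14 p. 244; §16 p. 250] -/
theorem sievedDisc_conv3_eq {a : ℤ} {z x : ℝ} {c g₁ g₂ : ArithmeticFunction ℝ} {SL SM SN : Finset ℕ}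
    (hSL : ∀ l, c l ≠ 0 → l ∈ SL) (hcr : ∀ l, c l ≠ 0 → IsRough z l)
    (hg₁ : ∀ m, g₁ m = if m ∈ SM then roughIndicator z m else 0)
    (hg₂ : ∀ n, g₂ n = if n ∈ SN then roughIndicator z n else 0)
    (hK : ∀ l ∈ SL, ∀ m ∈ SM, ∀ n ∈ SN, l * m * n ∈ Ioc ⌊x⌋₊ ⌊2 * x⌋₊)
    {d : ℕ} (hda : IsCoprime (d : ℤ) a) :
    sievedDisc (fun k => (c * g₁ * g₂) k) d a z x =
      ∑ l ∈ SL, if l.Coprime d then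
        c l * (setCongrCount a z SM SN l d - setCoprimeCount z SM SN d / (Nat.totient d : ℝ)) else 0 := by
  classical
  -- supports of `g₁`, `g₂`
  have hSM : ∀ m, g₁ m ≠ 0 → m ∈ SM := fun m hm => by
    by_contra h; rw [hg₁ m, if_neg h] at hm; exact hm rfl
  have hSN : ∀ n, g₂ n ≠ 0 → n ∈ SN := fun n hn => by
    by_contra h; rw [hg₂ n, if_neg h] at hn; exact hn rfl
  have hK' : ∀ l m n, c l ≠ 0 → g₁ m ≠ 0 → g₂ n ≠ 0 → l * m * n ∈ Ioc ⌊x⌋₊ ⌊2 * x⌋₊ :=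
    fun l m n hl hm hn => hK l (hSL l hl) m (hSM m hm) n (hSN n hn)
  -- the two filtered sums, for a general side condition `P`
  have hexp : ∀ (P : ℕ → Prop) [DecidablePred P],
      (∑ k ∈ Ioc ⌊x⌋₊ ⌊2 * x⌋₊, if IsRough z k ∧ P k then (c * g₁ * g₂) k else 0) =
        ∑ l ∈ SL, c l * ∑ m ∈ SM, ∑ n ∈ SN,
          (if P (l * m * n) then roughIndicator z m * roughIndicator z n else 0) := by
    intro P _
    have h1 : (∑ k ∈ Ioc ⌊x⌋₊ ⌊2 * x⌋₊, if IsRough z k ∧ P k then (c * g₁ * g₂) k else 0) =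
        ∑ k ∈ Ioc ⌊x⌋₊ ⌊2 * x⌋₊, (if IsRough z k ∧ P k then (1 : ℝ) else 0) * (c * g₁ * g₂) k :=
      Finset.sum_congr rfl fun k _ => by split_ifs <;> simp
    rw [h1, sum_mul_conv3_eq_sum_sum_sum c g₁ g₂ _ hSL hSM hSN hK']
    refine Finset.sum_congr rfl fun l _ => ?_
    rw [Finset.mul_sum]
    refine Finset.sum_congr rfl fun m hm => ?_
    rw [Finset.mul_sum]
    refine Finset.sum_congr rfl fun n hn => ?_
    rw [hg₁ m, if_pos hm, hg₂ n, if_pos hn]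
    by_cases hP : P (l * m * n)
    · by_cases hr : IsRough z (l * m * n)
      · rw [if_pos ⟨hr, hP⟩, if_pos hP]; ring
      · -- some factor is not rough, so the product of coefficients vanishes
        rw [if_neg (fun h => hr h.1), if_pos hP, zero_mul]
        by_cases hc0 : c l = 0
        · rw [hc0]; ring
        have hlr : IsRough z l := hcr l hc0
        by_cases hmr : IsRough z m
        · by_cases hnr : IsRough z n
          · exact absurd ((hlr.mul hmr).mul hnr) hr
          · rw [roughIndicator_eq_ite z n, if_neg hnr]; ring
        · rw [roughIndicator_eq_ite z m, if_neg hmr]; ring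
    · rw [if_neg (fun h => hP h.2), if_neg hP]; ring
  unfold sievedDisc
  rw [hexp (fun k : ℕ => (k : ZMod d) = (a : ZMod d)), hexp (fun k : ℕ => k.Coprime d)]
  -- identify the inner sums
  have hcong : ∀ l ∈ SL, c l * ∑ m ∈ SM, ∑ n ∈ SN,
      (if ((l * m * n : ℕ) : ZMod d) = (a : ZMod d) then roughIndicator z m * roughIndicator z n else 0) =
      if l.Coprime d then c l * setCongrCount a z SM SN l d else 0 := by
    intro l _
    by_cases hl : l.Coprime d
    · rw [if_pos hl]; rfl
    · rw [if_neg hl]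
      have := setCongrCount_eq_zero_of_not_coprime hda hl z SM SN
      unfold setCongrCount at this
      rw [this, mul_zero]
  have hcop : ∀ l ∈ SL, c l * ∑ m ∈ SM, ∑ n ∈ SN,
      (if (l * m * n).Coprime d then roughIndicator z m * roughIndicator z n else 0) =
      if l.Coprime d then c l * setCoprimeCount z SM SN d else 0 := by
    intro l _
    by_cases hl : l.Coprime d
    · rw [if_pos hl]
      unfold setCoprimeCount
      congr 1
      refine Finset.sum_congr rfl fun m _ => Finset.sum_congr rfl fun n _ => ?_
      have hiff : (l * m * n).Coprime d ↔ (m * n).Coprime d := by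
        rw [coprime_mul3_iff]; exact ⟨fun h => h.2, fun h => ⟨hl, h⟩⟩
      by_cases h : (m * n).Coprime d
      · rw [if_pos h, if_pos (hiff.2 h)]
      · rw [if_neg h, if_neg (fun h' => h (hiff.1 h'))]
    · rw [if_neg hl]
      convert mul_zero (c l) using 2
      refine Finset.sum_eq_zero fun m _ => Finset.sum_eq_zero fun n _ => ?_
      rw [if_neg]
      exact fun h => hl ((coprime_mul3_iff l m n d).1 h).1
  rw [Finset.sum_congr rfl hcong, Finset.sum_congr rfl hcop, Finset.sum_div, ← Finset.sum_sub_distrib]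
  refine Finset.sum_congr rfl fun l _ => ?_
  split_ifs <;> ring

/-- **A triple piece against the pair sum of Theorem 9** (BFI §16: the `q`-sum inside, at fixed
`r`, is the `q`-sum `setQSum` of the brackets of `Δ*`, §14 p. 244, with the side conditions
`(l, r) = 1`, `(q, al) = 1`).  In the setting of `sievedDisc_conv3_eq`, for `(r, a) = 1`:
`∑_{q ≤ Q, (q,a)=1} sievedDisc (c ⋆ g₁ ⋆ g₂) (qr) = ∑_{l ∈ SL, (l,r)=1} c(l) · setQSum(a, z, SM, SN, [1,Q]; r, l)`.
[cite: BombieriFriedlanderIwaniecActa1986, §14 p. 244; §16 p. 250] -/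
theorem sum_sievedDisc_conv3_eq_sum_setQSum {a : ℤ} {z x : ℝ} {c g₁ g₂ : ArithmeticFunction ℝ}
    {SL SM SN : Finset ℕ}
    (hSL : ∀ l, c l ≠ 0 → l ∈ SL) (hcr : ∀ l, c l ≠ 0 → IsRough z l)
    (hg₁ : ∀ m, g₁ m = if m ∈ SM then roughIndicator z m else 0)
    (hg₂ : ∀ n, g₂ n = if n ∈ SN then roughIndicator z n else 0)
    (hK : ∀ l ∈ SL, ∀ m ∈ SM, ∀ n ∈ SN, l * m * n ∈ Ioc ⌊x⌋₊ ⌊2 * x⌋₊)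
    {r : ℕ} (hra : IsCoprime (r : ℤ) a) (Q : ℝ) :
    ∑ q ∈ (Icc 1 ⌊Q⌋₊).filter (fun q : ℕ => IsCoprime (q : ℤ) a),
        sievedDisc (fun k => (c * g₁ * g₂) k) (q * r) a z x =
      ∑ l ∈ SL.filter (fun l : ℕ => l.Coprime r), c l * setQSum a z SM SN (Icc 1 ⌊Q⌋₊) r l := by
  classical
  have hstep : ∀ q ∈ (Icc 1 ⌊Q⌋₊).filter (fun q : ℕ => IsCoprime (q : ℤ) a),
      sievedDisc (fun k => (c * g₁ * g₂) k) (q * r) a z x =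
        ∑ l ∈ SL, if l.Coprime (q * r) then
          c l * (setCongrCount a z SM SN l (q * r) -
            setCoprimeCount z SM SN (q * r) / (Nat.totient (q * r) : ℝ)) else 0 := by
    intro q hq
    have hqa : IsCoprime (q : ℤ) a := (Finset.mem_filter.1 hq).2
    have hda : IsCoprime ((q * r : ℕ) : ℤ) a := by push_cast; exact hqa.mul_left hra
    exact sievedDisc_conv3_eq hSL hcr hg₁ hg₂ hK hda
  rw [Finset.sum_congr rfl hstep, Finset.sum_comm, Finset.sum_filter]
  refine Finset.sum_congr rfl fun l _ => ?_
  by_cases hlr : l.Coprime r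
  · rw [if_pos hlr, setQSum, Finset.mul_sum, Finset.sum_filter, Finset.sum_filter]
    refine Finset.sum_congr rfl fun q _ => ?_
    have hiff : IsCoprime (q : ℤ) a ∧ l.Coprime (q * r) ↔ IsCoprime (q : ℤ) (a * l) := by
      rw [Nat.coprime_mul_iff_right, IsCoprime.mul_right_iff, Nat.isCoprime_iff_coprime,
        Nat.coprime_comm (m := q)]
      tauto
    by_cases h1 : IsCoprime (q : ℤ) a
    · rw [if_pos h1]
      by_cases h3 : l.Coprime (q * r)
      · rw [if_pos h3, if_pos (hiff.1 ⟨h1, h3⟩)]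
      · rw [if_neg h3, if_neg (fun h => h3 (hiff.2 h).2)]
    · rw [if_neg h1, if_neg (fun h => h1 (hiff.2 h).1)]
  · rw [if_neg hlr]
    refine Finset.sum_eq_zero fun q _ => ?_
    rw [if_neg]
    exact fun h2 => hlr (Nat.coprime_mul_iff_right.1 h2).2


/-! ### The reduction of Case II: `|c_l| |·| ≤ (η c_l² |·| + η⁻¹ |·|)/2` -/

/-- `|c| |s| ≤ (η c² |s| + η⁻¹ |s|)/2` for `η > 0`. [folklore] -/
theorem abs_mul_abs_le_amgm {η : ℝ} (hη : 0 < η) (c s : ℝ) :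
    |c| * |s| ≤ (η * c ^ 2 * |s| + η⁻¹ * |s|) / 2 := by
  have hs : 0 ≤ |s| := abs_nonneg s
  have h1 : 0 ≤ (η * |c| - 1) ^ 2 * |s| := by positivity
  have h2 : (η * |c| - 1) ^ 2 = η ^ 2 * c ^ 2 - 2 * η * |c| + 1 := by rw [← sq_abs c]; ring
  rw [h2] at h1
  rw [le_div_iff₀ (by norm_num : (0 : ℝ) < 2)]
  have h3 : η * (2 * |c| * |s|) ≤ η * (η * c ^ 2 * |s| + η⁻¹ * |s|) := by
    have : η * (η * c ^ 2 * |s| + η⁻¹ * |s|) = η ^ 2 * c ^ 2 * |s| + |s| := by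
      field_simp
    rw [this]; nlinarith
  have := le_of_mul_le_mul_left h3 hη
  linarith

/-- `|setQSum| ≤ ∑_{q ≤ Q} (setCongrCount + setCoprimeCount/φ)` (drop the filter; both counts are
nonnegative). [folklore] -/
theorem abs_setQSum_le (a : ℤ) (z : ℝ) (SM SN : Finset ℕ) (Q : ℝ) (r l : ℕ) :
    |setQSum a z SM SN (Icc 1 ⌊Q⌋₊) r l| ≤
      ∑ q ∈ Icc 1 ⌊Q⌋₊, (setCongrCount a z SM SN l (q * r) +
        setCoprimeCount z SM SN (q * r) / (Nat.totient (q * r) : ℝ)) := by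
  have hρ : ∀ m n, 0 ≤ roughIndicator z m * roughIndicator z n := fun m n =>
    mul_nonneg (roughIndicator_nonneg z m) (roughIndicator_nonneg z n)
  have hA0 : ∀ d, 0 ≤ setCongrCount a z SM SN l d := fun d =>
    Finset.sum_nonneg fun m _ => Finset.sum_nonneg fun n _ => by split_ifs <;> [exact hρ m n; exact le_rfl]
  have hB0 : ∀ d, 0 ≤ setCoprimeCount z SM SN d / (Nat.totient d : ℝ) := fun d =>
    div_nonneg (Finset.sum_nonneg fun m _ => Finset.sum_nonneg fun n _ => by
      split_ifs <;> [exact hρ m n; exact le_rfl]) (Nat.cast_nonneg _)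
  unfold setQSum
  refine (Finset.abs_sum_le_sum_abs _ _).trans ?_
  refine (Finset.sum_le_sum fun q _ => ?_).trans
    (Finset.sum_le_sum_of_subset_of_nonneg (Finset.filter_subset _ _) fun q _ _ =>
      add_nonneg (hA0 _) (hB0 _))
  exact (abs_sub _ _).trans (by rw [abs_of_nonneg (hA0 _), abs_of_nonneg (hB0 _)])

/-- **The reduction of Case II.**  For a triple piece `c ⋆ g₁ ⋆ g₂` as in
`sum_sievedDisc_conv3_eq_sum_setQSum`, with `SL` consisting of `z`-rough integers and `|δ| ≤ 1`:
for every `η > 0`,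
`|∑_{r ≤ R,(r,a)=1} δ_r ∑_{q ≤ Q,(q,a)=1} sievedDisc (c ⋆ g₁ ⋆ g₂) (qr)|
  ≤ (η/2) T₁ + (2η)⁻¹ Δ*_sets(SM, SN, SL, [1,Q], [1,R])`,
where `T₁ = ∑_{r ≤ R} ∑_{l ∈ SL} c_l² ∑_{q ≤ Q} (setCongrCount(l, qr) + setCoprimeCount(qr)/φ(qr))`
(the trivial majorant with the squared coefficients) and `Δ*_sets` is the block sum of BFI §14
(`BFI.deltaStarSets`, to be bounded by Theorem 7*).  This replaces the supremum bound
`|c_l| ≤ τ_k(l) ≪ ℒ^{log k}` for `z₀`-rough `l` of the print (which is why the source takes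
`z = z₀ = exp(log x/log log x)`) by the inequality `2|c||s| ≤ η c²|s| + η⁻¹|s|`, so that any
sifting level `z` will do. [cite: BombieriFriedlanderIwaniecActa1986, §16 p. 250; §14 p. 244] -/
theorem caseII_reduction {a : ℤ} {z x : ℝ} {c g₁ g₂ : ArithmeticFunction ℝ} {SL SM SN : Finset ℕ}
    (hSL : ∀ l, c l ≠ 0 → l ∈ SL) (hcr : ∀ l, c l ≠ 0 → IsRough z l)
    (hg₁ : ∀ m, g₁ m = if m ∈ SM then roughIndicator z m else 0)
    (hg₂ : ∀ n, g₂ n = if n ∈ SN then roughIndicator z n else 0)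
    (hK : ∀ l ∈ SL, ∀ m ∈ SM, ∀ n ∈ SN, l * m * n ∈ Ioc ⌊x⌋₊ ⌊2 * x⌋₊)
    (hSLr : ∀ l ∈ SL, IsRough z l) (Q R : ℝ) {δ : ℕ → ℝ} (hδ : ∀ r, |δ r| ≤ 1) {η : ℝ} (hη : 0 < η) :
    |∑ r ∈ (Icc 1 ⌊R⌋₊).filter (fun r : ℕ => IsCoprime (r : ℤ) a),
        δ r * ∑ q ∈ (Icc 1 ⌊Q⌋₊).filter (fun q : ℕ => IsCoprime (q : ℤ) a),
          sievedDisc (fun k => (c * g₁ * g₂) k) (q * r) a z x| ≤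
      η / 2 * ∑ r ∈ Icc 1 ⌊R⌋₊, ∑ l ∈ SL, c l ^ 2 * ∑ q ∈ Icc 1 ⌊Q⌋₊,
          (setCongrCount a z SM SN l (q * r) + setCoprimeCount z SM SN (q * r) / (Nat.totient (q * r) : ℝ)) +
        η⁻¹ / 2 * deltaStarSets a z SM SN SL (Icc 1 ⌊Q⌋₊) (Icc 1 ⌊R⌋₊) := by
  classical
  set SR : Finset ℕ := (Icc 1 ⌊R⌋₊).filter (fun r : ℕ => IsCoprime (r : ℤ) a) with hSR
  set sQ : ℕ → ℕ → ℝ := fun r l => setQSum a z SM SN (Icc 1 ⌊Q⌋₊) r l with hsQ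
  set W : ℕ → ℕ → ℝ := fun r l => ∑ q ∈ Icc 1 ⌊Q⌋₊,
    (setCongrCount a z SM SN l (q * r) + setCoprimeCount z SM SN (q * r) / (Nat.totient (q * r) : ℝ)) with hW
  -- Step 1: the identity and `|δ| ≤ 1`
  have h1 : |∑ r ∈ SR, δ r * ∑ q ∈ (Icc 1 ⌊Q⌋₊).filter (fun q : ℕ => IsCoprime (q : ℤ) a),
      sievedDisc (fun k => (c * g₁ * g₂) k) (q * r) a z x| ≤
      ∑ r ∈ SR, ∑ l ∈ SL.filter (fun l : ℕ => l.Coprime r), |c l| * |sQ r l| := by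
    refine (Finset.abs_sum_le_sum_abs _ _).trans (Finset.sum_le_sum fun r hr => ?_)
    have hra : IsCoprime (r : ℤ) a := (Finset.mem_filter.1 hr).2
    rw [sum_sievedDisc_conv3_eq_sum_setQSum hSL hcr hg₁ hg₂ hK hra Q, abs_mul]
    calc |δ r| * |∑ l ∈ SL.filter (fun l : ℕ => l.Coprime r), c l * setQSum a z SM SN (Icc 1 ⌊Q⌋₊) r l|
        ≤ 1 * |∑ l ∈ SL.filter (fun l : ℕ => l.Coprime r), c l * setQSum a z SM SN (Icc 1 ⌊Q⌋₊) r l| :=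
          mul_le_mul_of_nonneg_right (hδ r) (abs_nonneg _)
      _ ≤ ∑ l ∈ SL.filter (fun l : ℕ => l.Coprime r), |c l| * |sQ r l| := by
          rw [one_mul]
          refine (Finset.abs_sum_le_sum_abs _ _).trans (le_of_eq (Finset.sum_congr rfl fun l _ => ?_))
          rw [abs_mul]
  -- Step 2: `|c||s| ≤ (η c²|s| + η⁻¹|s|)/2`
  have h2 : ∑ r ∈ SR, ∑ l ∈ SL.filter (fun l : ℕ => l.Coprime r), |c l| * |sQ r l| ≤
      ∑ r ∈ SR, ∑ l ∈ SL.filter (fun l : ℕ => l.Coprime r),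
        (η * c l ^ 2 * |sQ r l| + η⁻¹ * |sQ r l|) / 2 :=
    Finset.sum_le_sum fun r _ => Finset.sum_le_sum fun l _ => abs_mul_abs_le_amgm hη _ _
  -- Step 3: the two halves
  have h3 : ∑ r ∈ SR, ∑ l ∈ SL.filter (fun l : ℕ => l.Coprime r),
      (η * c l ^ 2 * |sQ r l| + η⁻¹ * |sQ r l|) / 2 =
      η / 2 * ∑ r ∈ SR, ∑ l ∈ SL.filter (fun l : ℕ => l.Coprime r), c l ^ 2 * |sQ r l| +
        η⁻¹ / 2 * ∑ r ∈ SR, ∑ l ∈ SL.filter (fun l : ℕ => l.Coprime r), |sQ r l| := by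
    rw [Finset.mul_sum, Finset.mul_sum, ← Finset.sum_add_distrib]
    refine Finset.sum_congr rfl fun r _ => ?_
    rw [Finset.mul_sum, Finset.mul_sum, ← Finset.sum_add_distrib]
    exact Finset.sum_congr rfl fun l _ => by ring
  -- the first half: enlarge the ranges and drop the filter of `setQSum`
  have h4 : ∑ r ∈ SR, ∑ l ∈ SL.filter (fun l : ℕ => l.Coprime r), c l ^ 2 * |sQ r l| ≤
      ∑ r ∈ Icc 1 ⌊R⌋₊, ∑ l ∈ SL, c l ^ 2 * W r l := by
    calc ∑ r ∈ SR, ∑ l ∈ SL.filter (fun l : ℕ => l.Coprime r), c l ^ 2 * |sQ r l|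
        ≤ ∑ r ∈ SR, ∑ l ∈ SL, c l ^ 2 * |sQ r l| :=
          Finset.sum_le_sum fun r _ => Finset.sum_le_sum_of_subset_of_nonneg (Finset.filter_subset _ _)
            fun l _ _ => by positivity
      _ ≤ ∑ r ∈ Icc 1 ⌊R⌋₊, ∑ l ∈ SL, c l ^ 2 * |sQ r l| :=
          Finset.sum_le_sum_of_subset_of_nonneg (Finset.filter_subset _ _) fun r _ _ =>
            Finset.sum_nonneg fun l _ => by positivity
      _ ≤ ∑ r ∈ Icc 1 ⌊R⌋₊, ∑ l ∈ SL, c l ^ 2 * W r l :=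
          Finset.sum_le_sum fun r _ => Finset.sum_le_sum fun l _ =>
            mul_le_mul_of_nonneg_left (abs_setQSum_le a z SM SN Q r l) (sq_nonneg _)
  -- the second half is `deltaStarSets` (the weight `1_rough(l)` is `1` on `SL`)
  have h5 : ∑ r ∈ SR, ∑ l ∈ SL.filter (fun l : ℕ => l.Coprime r), |sQ r l| =
      deltaStarSets a z SM SN SL (Icc 1 ⌊Q⌋₊) (Icc 1 ⌊R⌋₊) := by
    unfold deltaStarSets
    refine Finset.sum_congr rfl fun r _ => Finset.sum_congr rfl fun l hl => ?_
    rw [roughIndicator_eq_ite, if_pos (hSLr l (Finset.mem_filter.1 hl).1), one_mul]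
  calc _ ≤ _ := h1
    _ ≤ _ := h2
    _ = _ := h3
    _ ≤ _ := by
        rw [h5]
        refine add_le_add (mul_le_mul_of_nonneg_left h4 (by positivity)) le_rfl

/-! ### The trivial majorant `T₁` of Case II -/

/-- Moving the two inner sums of a fourfold sum outside. [folklore] -/
theorem sum4_comm {α β γ δ M : Type*} [AddCommMonoid M] (A : Finset α) (B : Finset β) (C : Finset γ)
    (D : Finset δ) (f : α → β → γ → δ → M) :
    ∑ a ∈ A, ∑ b ∈ B, ∑ c ∈ C, ∑ d ∈ D, f a b c d = ∑ c ∈ C, ∑ d ∈ D, ∑ a ∈ A, ∑ b ∈ B, f a b c d := by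
  calc ∑ a ∈ A, ∑ b ∈ B, ∑ c ∈ C, ∑ d ∈ D, f a b c d
      = ∑ a ∈ A, ∑ c ∈ C, ∑ b ∈ B, ∑ d ∈ D, f a b c d := Finset.sum_congr rfl fun _ _ => Finset.sum_comm
    _ = ∑ c ∈ C, ∑ a ∈ A, ∑ b ∈ B, ∑ d ∈ D, f a b c d := Finset.sum_comm
    _ = ∑ c ∈ C, ∑ a ∈ A, ∑ d ∈ D, ∑ b ∈ B, f a b c d :=
        Finset.sum_congr rfl fun _ _ => Finset.sum_congr rfl fun _ _ => Finset.sum_comm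
    _ = ∑ c ∈ C, ∑ d ∈ D, ∑ a ∈ A, ∑ b ∈ B, f a b c d := Finset.sum_congr rfl fun _ _ => Finset.sum_comm

/-- **Sums over triples in boxes, fibered over the product.**  For `SL × SM × SN` mapped by
`(l, m, n) ↦ lmn` into `K ∌ 0`, `v(l) ≤ τ(l)^e` and `w ≥ 0`:
`∑_{l,m,n} v(l) w(lmn) ≤ ∑_{k ∈ K} τ(k)^{e+2} w(k)` (`τ(l) ≤ τ(k)` for `l ∣ k`, and each `k` has at
most `τ(k)²` factorisations, `BFI.card_triples_le`). [folklore] -/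
theorem sum_triples_le_sum_fiber {SL SM SN K : Finset ℕ} (h0 : 0 ∉ K)
    (hK : ∀ l ∈ SL, ∀ m ∈ SM, ∀ n ∈ SN, l * m * n ∈ K) {v w : ℕ → ℝ} {e : ℕ}
    (hv : ∀ l, l ≠ 0 → v l ≤ (σ 0 l : ℝ) ^ e) (hw : ∀ k, 0 ≤ w k) :
    ∑ l ∈ SL, ∑ m ∈ SM, ∑ n ∈ SN, v l * w (l * m * n) ≤
      ∑ k ∈ K, (σ 0 k : ℝ) ^ (e + 2) * w k := by
  classical
  have hprod : ∑ l ∈ SL, ∑ m ∈ SM, ∑ n ∈ SN, v l * w (l * m * n) =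
      ∑ p ∈ SL ×ˢ (SM ×ˢ SN), v p.1 * w (p.1 * p.2.1 * p.2.2) := by
    rw [Finset.sum_product]
    exact Finset.sum_congr rfl fun l _ => by rw [Finset.sum_product]
  rw [hprod]
  have hmaps : ∀ p ∈ SL ×ˢ (SM ×ˢ SN), p.1 * p.2.1 * p.2.2 ∈ K := by
    intro p hp
    rw [Finset.mem_product, Finset.mem_product] at hp
    exact hK _ hp.1 _ hp.2.1 _ hp.2.2
  rw [← Finset.sum_fiberwise_of_maps_to hmaps]
  refine Finset.sum_le_sum fun k hk => ?_
  have hk0 : k ≠ 0 := fun h => h0 (h ▸ hk)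
  have hτk : (1 : ℝ) ≤ (σ 0 k : ℝ) := by exact_mod_cast one_le_sigma_zero hk0
  calc ∑ p ∈ (SL ×ˢ (SM ×ˢ SN)).filter (fun p => p.1 * p.2.1 * p.2.2 = k), v p.1 * w (p.1 * p.2.1 * p.2.2)
      ≤ ∑ p ∈ (SL ×ˢ (SM ×ˢ SN)).filter (fun p => p.1 * p.2.1 * p.2.2 = k), (σ 0 k : ℝ) ^ e * w k := by
        refine Finset.sum_le_sum fun p hp => ?_
        have hpk : p.1 * p.2.1 * p.2.2 = k := (Finset.mem_filter.1 hp).2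
        rw [hpk]
        refine mul_le_mul_of_nonneg_right ?_ (hw k)
        have hl0 : p.1 ≠ 0 := by
          intro h; apply hk0; rw [← hpk, h]; ring
        have hdvd : p.1 ∣ k := ⟨p.2.1 * p.2.2, by rw [← hpk]; ring⟩
        calc v p.1 ≤ (σ 0 p.1 : ℝ) ^ e := hv _ hl0
          _ ≤ (σ 0 k : ℝ) ^ e := pow_le_pow_left₀ (Nat.cast_nonneg _)
              (by exact_mod_cast sigma_zero_le_of_dvd hk0 hdvd) e
    _ = ((SL ×ˢ (SM ×ˢ SN)).filter (fun p => p.1 * p.2.1 * p.2.2 = k)).card * ((σ 0 k : ℝ) ^ e * w k) := by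
        rw [Finset.sum_const, nsmul_eq_mul]
    _ ≤ (σ 0 k : ℝ) ^ 2 * ((σ 0 k : ℝ) ^ e * w k) := by
        refine mul_le_mul_of_nonneg_right ?_ (mul_nonneg (by positivity) (hw k))
        have h := card_triples_le hk0 SL SM SN
        rw [← ArithmeticFunction.sigma_zero_apply] at h
        exact_mod_cast h
    _ = (σ 0 k : ℝ) ^ (e + 2) * w k := by ring

/-- For `n − a ≠ 0` (natural `n`, integer `a`), the pairs `(q, r)`, `q ≤ Qn`, `r ≤ Rn`, with
`n ≡ a (mod qr)` number at most `τ(|n − a|)²` (sum over `r` outside). [folklore] -/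
theorem sum_sum_congr_indicator_le' {n : ℕ} {a : ℤ} (hna : (n : ℤ) - a ≠ 0) (Qn Rn : ℕ) :
    ∑ r ∈ Icc 1 Rn, ∑ q ∈ Icc 1 Qn,
        (if (n : ZMod (q * r)) = (a : ZMod (q * r)) then (1 : ℝ) else 0) ≤
      (σ 0 ((n : ℤ) - a).natAbs : ℝ) ^ 2 := by
  rw [Finset.sum_comm]
  calc ∑ q ∈ Icc 1 Qn, ∑ r ∈ Icc 1 Rn,
        (if (n : ZMod (q * r)) = (a : ZMod (q * r)) then (1 : ℝ) else 0)
      ≤ ∑ q ∈ Icc 1 Qn, ∑ r ∈ Icc 1 Rn,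
          (if (((q * r : ℕ) : ℤ)) ∣ (n : ℤ) - a then (1 : ℝ) else 0) := by
        refine Finset.sum_le_sum fun q _ => Finset.sum_le_sum fun r _ => ?_
        by_cases hc : (n : ZMod (q * r)) = (a : ZMod (q * r))
        · rw [if_pos hc, if_pos]
          have h1 : (((n : ℕ) : ℤ) : ZMod (q * r)) = ((a : ℤ) : ZMod (q * r)) := by
            rw [Int.cast_natCast]; exact hc
          rw [ZMod.intCast_eq_intCast_iff_dvd_sub] at h1
          rwa [dvd_sub_comm] at h1
        · rw [if_neg hc]; split_ifs <;> norm_num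
    _ ≤ _ := by
        have h := sum_sum_dvd_indicator_le Qn Rn ((n : ℤ) - a)
        rwa [if_neg hna] at h

/-- **The trivial majorant `T₁` of Case II** against divisor moments: with `|c_l| ≤ τ(l)^{13}` and
`lmn ∈ (x, 2x]` on `SL × SM × SN`, `x ≥ |a|`,
`T₁ ≤ ∑_{x<k≤2x} τ(k)^{28} τ(k − a)² + (∑_{r≤R} ∑_{q≤Q} 1/φ(qr)) ∑_{x<k≤2x} τ(k)^{28}`.
[cite: BombieriFriedlanderIwaniecActa1986, §16 p. 250 (the "trivial" estimates of §15)] -/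
theorem caseII_T1_le {a : ℤ} {z x : ℝ} {c : ArithmeticFunction ℝ} {SL SM SN : Finset ℕ}
    (hx : |(a : ℝ)| ≤ x) (hc : ∀ l, |c l| ≤ (σ 0 l : ℝ) ^ 13)
    (hK : ∀ l ∈ SL, ∀ m ∈ SM, ∀ n ∈ SN, l * m * n ∈ Ioc ⌊x⌋₊ ⌊2 * x⌋₊) (Q R : ℝ) :
    ∑ r ∈ Icc 1 ⌊R⌋₊, ∑ l ∈ SL, c l ^ 2 * ∑ q ∈ Icc 1 ⌊Q⌋₊,
        (setCongrCount a z SM SN l (q * r) + setCoprimeCount z SM SN (q * r) / (Nat.totient (q * r) : ℝ)) ≤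
      (∑ k ∈ Ioc ⌊x⌋₊ ⌊2 * x⌋₊, (σ 0 k : ℝ) ^ 28 * (σ 0 ((k : ℤ) - a).natAbs : ℝ) ^ 2) +
        (∑ r ∈ Icc 1 ⌊R⌋₊, ∑ q ∈ Icc 1 ⌊Q⌋₊, ((Nat.totient (q * r) : ℝ))⁻¹) *
          ∑ k ∈ Ioc ⌊x⌋₊ ⌊2 * x⌋₊, (σ 0 k : ℝ) ^ 28 := by
  classical
  set Φ : ℝ := ∑ r ∈ Icc 1 ⌊R⌋₊, ∑ q ∈ Icc 1 ⌊Q⌋₊, ((Nat.totient (q * r) : ℝ))⁻¹ with hΦ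
  have hΦ0 : 0 ≤ Φ := Finset.sum_nonneg fun _ _ => Finset.sum_nonneg fun _ _ => inv_nonneg.2 (Nat.cast_nonneg _)
  have hρ1 : ∀ m n, roughIndicator z m * roughIndicator z n ≤ 1 := fun m n => by
    have h1 : roughIndicator z m ≤ 1 := by unfold roughIndicator; split_ifs <;> norm_num
    have h2 : roughIndicator z n ≤ 1 := by unfold roughIndicator; split_ifs <;> norm_num
    calc roughIndicator z m * roughIndicator z n ≤ 1 * 1 :=
          mul_le_mul h1 h2 (roughIndicator_nonneg z n) zero_le_one
      _ = 1 := one_mul 1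
  have hρ0 : ∀ m n, 0 ≤ roughIndicator z m * roughIndicator z n := fun m n =>
    mul_nonneg (roughIndicator_nonneg z m) (roughIndicator_nonneg z n)
  -- `lmn − a ≠ 0` on the boxes
  have hna : ∀ l ∈ SL, ∀ m ∈ SM, ∀ n ∈ SN, ((l * m * n : ℕ) : ℤ) - a ≠ 0 := by
    intro l hl m hm n hn
    have hxk : x < ((l * m * n : ℕ) : ℝ) := Nat.lt_of_floor_lt (Finset.mem_Ioc.1 (hK l hl m hm n hn)).1
    have : (a : ℝ) < ((l * m * n : ℕ) : ℝ) := ((le_abs_self (a : ℝ)).trans hx).trans_lt hxk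
    have : a < ((l * m * n : ℕ) : ℤ) := by exact_mod_cast this
    omega
  -- Step 1: swap `r` and `l`, and split the two counts
  have hswap : ∑ r ∈ Icc 1 ⌊R⌋₊, ∑ l ∈ SL, c l ^ 2 * ∑ q ∈ Icc 1 ⌊Q⌋₊,
      (setCongrCount a z SM SN l (q * r) + setCoprimeCount z SM SN (q * r) / (Nat.totient (q * r) : ℝ)) =
      ∑ l ∈ SL, c l ^ 2 * ((∑ r ∈ Icc 1 ⌊R⌋₊, ∑ q ∈ Icc 1 ⌊Q⌋₊, setCongrCount a z SM SN l (q * r)) +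
        ∑ r ∈ Icc 1 ⌊R⌋₊, ∑ q ∈ Icc 1 ⌊Q⌋₊, setCoprimeCount z SM SN (q * r) / (Nat.totient (q * r) : ℝ)) := by
    rw [Finset.sum_comm]
    refine Finset.sum_congr rfl fun l _ => ?_
    rw [← Finset.mul_sum, ← Finset.sum_add_distrib]
    congr 1
    exact Finset.sum_congr rfl fun r _ => Finset.sum_add_distrib
  rw [hswap]
  -- Step 2: the congruence counts, for fixed `l`
  have hcong : ∀ l ∈ SL, ∑ r ∈ Icc 1 ⌊R⌋₊, ∑ q ∈ Icc 1 ⌊Q⌋₊, setCongrCount a z SM SN l (q * r) ≤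
      ∑ m ∈ SM, ∑ n ∈ SN, (σ 0 (((l * m * n : ℕ) : ℤ) - a).natAbs : ℝ) ^ 2 := by
    intro l hl
    unfold setCongrCount
    rw [sum4_comm]
    refine Finset.sum_le_sum fun m hm => Finset.sum_le_sum fun n hn => ?_
    calc ∑ r ∈ Icc 1 ⌊R⌋₊, ∑ q ∈ Icc 1 ⌊Q⌋₊,
          (if ((l * m * n : ℕ) : ZMod (q * r)) = (a : ZMod (q * r)) then
            roughIndicator z m * roughIndicator z n else 0)
        ≤ ∑ r ∈ Icc 1 ⌊R⌋₊, ∑ q ∈ Icc 1 ⌊Q⌋₊,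
          (if ((l * m * n : ℕ) : ZMod (q * r)) = (a : ZMod (q * r)) then (1 : ℝ) else 0) := by
          refine Finset.sum_le_sum fun r _ => Finset.sum_le_sum fun q _ => ?_
          split_ifs <;> [exact hρ1 _ _; exact le_rfl]
      _ ≤ _ := sum_sum_congr_indicator_le' (hna l hl m hm n hn) _ _
  -- Step 3: the coprime counts, for fixed `l`
  have hcop : ∀ l ∈ SL, ∑ r ∈ Icc 1 ⌊R⌋₊, ∑ q ∈ Icc 1 ⌊Q⌋₊,
      setCoprimeCount z SM SN (q * r) / (Nat.totient (q * r) : ℝ) ≤ Φ * ∑ m ∈ SM, ∑ n ∈ SN, (1 : ℝ) := by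
    intro l _
    rw [hΦ, Finset.sum_mul]
    refine Finset.sum_le_sum fun r _ => ?_
    rw [Finset.sum_mul]
    refine Finset.sum_le_sum fun q _ => ?_
    rw [div_eq_inv_mul]
    refine mul_le_mul_of_nonneg_left ?_ (inv_nonneg.2 (Nat.cast_nonneg _))
    unfold setCoprimeCount
    exact Finset.sum_le_sum fun m _ => Finset.sum_le_sum fun n _ => by
      split_ifs <;> [exact hρ1 _ _; exact zero_le_one]
  -- Step 4: combine, and fiber over `k = lmn`
  have hc2 : ∀ l, l ≠ 0 → c l ^ 2 ≤ (σ 0 l : ℝ) ^ 26 := by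
    intro l _
    calc c l ^ 2 = |c l| ^ 2 := (sq_abs _).symm
      _ ≤ ((σ 0 l : ℝ) ^ 13) ^ 2 := pow_le_pow_left₀ (abs_nonneg _) (hc l) 2
      _ = (σ 0 l : ℝ) ^ 26 := by rw [← pow_mul]
  have h0K : (0 : ℕ) ∉ Ioc ⌊x⌋₊ ⌊2 * x⌋₊ := by simp
  have hA : ∑ l ∈ SL, c l ^ 2 * ∑ m ∈ SM, ∑ n ∈ SN, (σ 0 (((l * m * n : ℕ) : ℤ) - a).natAbs : ℝ) ^ 2 ≤
      ∑ k ∈ Ioc ⌊x⌋₊ ⌊2 * x⌋₊, (σ 0 k : ℝ) ^ 28 * (σ 0 ((k : ℤ) - a).natAbs : ℝ) ^ 2 := by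
    have h := sum_triples_le_sum_fiber h0K hK (v := fun l => c l ^ 2)
      (w := fun k => (σ 0 ((k : ℤ) - a).natAbs : ℝ) ^ 2) hc2 (fun k => by positivity)
    refine le_trans (le_of_eq ?_) h
    refine Finset.sum_congr rfl fun l _ => ?_
    rw [Finset.mul_sum]
    exact Finset.sum_congr rfl fun m _ => by rw [Finset.mul_sum]
  have hB : ∑ l ∈ SL, c l ^ 2 * ∑ m ∈ SM, ∑ n ∈ SN, (1 : ℝ) ≤ ∑ k ∈ Ioc ⌊x⌋₊ ⌊2 * x⌋₊, (σ 0 k : ℝ) ^ 28 := by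
    have h := sum_triples_le_sum_fiber h0K hK (v := fun l => c l ^ 2) (w := fun _ => (1 : ℝ))
      hc2 (fun _ => zero_le_one)
    simp only [mul_one] at h
    refine le_trans (le_of_eq ?_) h
    refine Finset.sum_congr rfl fun l _ => ?_
    rw [Finset.mul_sum]
    refine Finset.sum_congr rfl fun m _ => ?_
    rw [Finset.mul_sum]
    exact Finset.sum_congr rfl fun n _ => by rw [mul_one]
  calc ∑ l ∈ SL, c l ^ 2 * ((∑ r ∈ Icc 1 ⌊R⌋₊, ∑ q ∈ Icc 1 ⌊Q⌋₊, setCongrCount a z SM SN l (q * r)) +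
        ∑ r ∈ Icc 1 ⌊R⌋₊, ∑ q ∈ Icc 1 ⌊Q⌋₊, setCoprimeCount z SM SN (q * r) / (Nat.totient (q * r) : ℝ))
      ≤ ∑ l ∈ SL, c l ^ 2 * ((∑ m ∈ SM, ∑ n ∈ SN, (σ 0 (((l * m * n : ℕ) : ℤ) - a).natAbs : ℝ) ^ 2) +
          Φ * ∑ m ∈ SM, ∑ n ∈ SN, (1 : ℝ)) :=
        Finset.sum_le_sum fun l hl => mul_le_mul_of_nonneg_left (add_le_add (hcong l hl) (hcop l hl)) (sq_nonneg _)
    _ = (∑ l ∈ SL, c l ^ 2 * ∑ m ∈ SM, ∑ n ∈ SN, (σ 0 (((l * m * n : ℕ) : ℤ) - a).natAbs : ℝ) ^ 2) +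
          Φ * ∑ l ∈ SL, c l ^ 2 * ∑ m ∈ SM, ∑ n ∈ SN, (1 : ℝ) := by
        rw [Finset.mul_sum (s := SL), ← Finset.sum_add_distrib]
        exact Finset.sum_congr rfl fun l _ => by ring
    _ ≤ _ := add_le_add hA (mul_le_mul_of_nonneg_left hB hΦ0)


/-! ### Case II assembled: the trivial majorant against divisor moments, the corners of the boxes -/

/-- `Δ*` with an empty range of `q` vanishes. [folklore] -/
theorem deltaStar_Q_zero (a : ℤ) (z M N L R : ℝ) : deltaStar a z M N L 0 R = 0 := by
  unfold deltaStar
  refine Finset.sum_eq_zero fun r _ => Finset.sum_eq_zero fun l _ => ?_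
  rw [Nat.floor_zero]
  simp

/-- `Δ*` with an empty range of `n` (`N < 1`) vanishes: both counts are empty. [folklore] -/
theorem deltaStar_eq_zero_of_N_lt_one (a : ℤ) (z M L Q R : ℝ) {N : ℝ} (hN : N < 1) :
    deltaStar a z M N L Q R = 0 := by
  have hN0 : ⌊N⌋₊ = 0 := Nat.floor_eq_zero.2 hN
  unfold deltaStar
  refine Finset.sum_eq_zero fun r _ => Finset.sum_eq_zero fun l _ => ?_
  have h1 : ∀ d, roughCongrCount a z M N l d = 0 := fun d => by
    unfold roughCongrCount; rw [hN0]; simp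
  have h2 : ∀ d, roughCoprimeCount z M N d = 0 := fun d => by
    unfold roughCoprimeCount; rw [hN0]; simp
  simp [h1, h2]

/-- **Case II of §16, reduced to divisor moments and the corners of the boxes.**  For `a ≠ 0` there
are `B_t, C_t ≥ 0`, `x₀` (from BFI Lemma 3 with `τ^{28}`) such that for `x ≥ x₀`: for a triple piece
`c ⋆ g₁ ⋆ g₂` (`|c| ≤ τ^{13}` supported in `SL ⊆ (L₁, L₂]` on `z`-rough integers, `g₁ = 1_{(Mlo,Mhi]}·1_rough`,
`g₂ = 1_{(Nlo,Nhi]}·1_rough`, `lmn ∈ (x, 2x]` on the boxes), moduli `⌊Q⌋, ⌊R⌋ ≤ x`, `|δ| ≤ 1`, and a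
uniform bound `Δ*(M, N, L₂, Q, R) ≤ W` at the corners `M ∈ {Mlo, Mhi}`, `N ∈ {Nlo, Nhi}` with `N ≥ 1`
(to be supplied by Theorem 7*, `caseII_corners`), one has for every `η > 0`
`|∑_r δ_r ∑_q sievedDisc (c ⋆ g₁ ⋆ g₂)(qr)| ≤ (η/2) C_t x (log x)^{B_t} + (2η)⁻¹ · 4W`
(`caseII_reduction`, `caseII_T1_le`, `tau_pow_moments_pairs_le`, and `BFI.deltaStarSets_Ioc_le` for the
inclusion–exclusion of the boxes into initial segments).
[cite: BombieriFriedlanderIwaniecActa1986, §16 (16.2) p. 250; §14 Theorem 7* p. 246] -/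
theorem caseII_bound (hL3 : BombieriFriedlanderIwaniecLemma3) {a : ℤ} (ha : a ≠ 0) :
    ∃ Bt Ct x₀ : ℝ, 0 ≤ Bt ∧ 0 ≤ Ct ∧ ∀ x : ℝ, x₀ ≤ x →
      ∀ (z : ℝ) (c g₁ g₂ : ArithmeticFunction ℝ) (SL : Finset ℕ) (L₁ L₂ Mlo Mhi Nlo Nhi Q R W η : ℝ)
        (δ : ℕ → ℝ),
      (∀ l, c l ≠ 0 → l ∈ SL) → (∀ l ∈ SL, IsRough z l) → (∀ l, |c l| ≤ (σ 0 l : ℝ) ^ 13) →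
      SL ⊆ Ioc ⌊L₁⌋₊ ⌊L₂⌋₊ →
      (∀ m, g₁ m = if m ∈ Ioc ⌊Mlo⌋₊ ⌊Mhi⌋₊ then roughIndicator z m else 0) →
      (∀ n, g₂ n = if n ∈ Ioc ⌊Nlo⌋₊ ⌊Nhi⌋₊ then roughIndicator z n else 0) →
      (∀ l ∈ SL, ∀ m ∈ Ioc ⌊Mlo⌋₊ ⌊Mhi⌋₊, ∀ n ∈ Ioc ⌊Nlo⌋₊ ⌊Nhi⌋₊, l * m * n ∈ Ioc ⌊x⌋₊ ⌊2 * x⌋₊) →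
      Mlo ≤ Mhi → Nlo ≤ Nhi → 0 ≤ Q → (⌊Q⌋₊ : ℝ) ≤ x → (⌊R⌋₊ : ℝ) ≤ x →
      (∀ r, |δ r| ≤ 1) → 0 ≤ W →
      (∀ M ∈ ({Mlo, Mhi} : Finset ℝ), ∀ N ∈ ({Nlo, Nhi} : Finset ℝ), 1 ≤ N →
        deltaStar a z M N L₂ Q R ≤ W) →
      0 < η →
      |∑ r ∈ (Icc 1 ⌊R⌋₊).filter (fun r : ℕ => IsCoprime (r : ℤ) a),
          δ r * ∑ q ∈ (Icc 1 ⌊Q⌋₊).filter (fun q : ℕ => IsCoprime (q : ℤ) a),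
            sievedDisc (fun k => (c * g₁ * g₂) k) (q * r) a z x| ≤
        η / 2 * (Ct * x * Real.log x ^ Bt) + η⁻¹ / 2 * (4 * W) := by
  obtain ⟨Bt, Ct, x₀, hBt, hCt, hmom⟩ := tau_pow_moments_pairs_le hL3 ha (k := 28) (by norm_num)
  refine ⟨Bt, Ct, max x₀ (|(a : ℝ)|), hBt, hCt, ?_⟩
  intro x hx z c g₁ g₂ SL L₁ L₂ Mlo Mhi Nlo Nhi Q R W η δ hSL hSLr hc hSLsub hg₁ hg₂ hK hMM hNN hQ0 hQx hRx
    hδ hW0 hcorner hη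
  have hx₀ : x₀ ≤ x := le_trans (le_max_left _ _) hx
  have hxa : |(a : ℝ)| ≤ x := le_trans (le_max_right _ _) hx
  have hcr : ∀ l, c l ≠ 0 → IsRough z l := fun l hl => hSLr l (hSL l hl)
  -- Step 1: the reduction
  refine (caseII_reduction hSL hcr hg₁ hg₂ hK hSLr Q R hδ hη).trans ?_
  refine add_le_add (mul_le_mul_of_nonneg_left ?_ (by positivity)) (mul_le_mul_of_nonneg_left ?_ (by positivity))
  · -- Step 2: `T₁` against the moments
    exact (caseII_T1_le hxa hc hK Q R).trans (hmom x hx₀ ⌊Q⌋₊ ⌊R⌋₊ hQx hRx)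
  · -- Step 3: `Δ*_sets` on the boxes against the corners
    have hmono : deltaStarSets a z (Ioc ⌊Mlo⌋₊ ⌊Mhi⌋₊) (Ioc ⌊Nlo⌋₊ ⌊Nhi⌋₊) SL (Icc 1 ⌊Q⌋₊) (Icc 1 ⌊R⌋₊) ≤
        deltaStarSets a z (Ioc ⌊Mlo⌋₊ ⌊Mhi⌋₊) (Ioc ⌊Nlo⌋₊ ⌊Nhi⌋₊) (Ioc ⌊L₁⌋₊ ⌊L₂⌋₊)
          (Ioc ⌊(0 : ℝ)⌋₊ ⌊Q⌋₊) (Ioc ⌊(0 : ℝ)⌋₊ ⌊R⌋₊) := by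
      rw [Nat.floor_zero]
      exact deltaStarSets_mono a z _ _ _ hSLsub (subset_refl _)
    refine hmono.trans ((deltaStarSets_Ioc_le a z hMM hNN hQ0 L₁ L₂ 0 R).trans ?_)
    simp only [deltaStar_Q_zero, add_zero]
    have hMhi : Mhi ∈ ({Mlo, Mhi} : Finset ℝ) := by simp
    have hMlo : Mlo ∈ ({Mlo, Mhi} : Finset ℝ) := by simp
    have hNhi : Nhi ∈ ({Nlo, Nhi} : Finset ℝ) := by simp
    have hNlo : Nlo ∈ ({Nlo, Nhi} : Finset ℝ) := by simp
    have hcN : ∀ M ∈ ({Mlo, Mhi} : Finset ℝ), ∀ N ∈ ({Nlo, Nhi} : Finset ℝ), deltaStar a z M N L₂ Q R ≤ W := by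
      intro M hM N hN
      rcases lt_or_ge N 1 with h1 | h1
      · rw [deltaStar_eq_zero_of_N_lt_one a z M L₂ Q R h1]; exact hW0
      · exact hcorner M hM N hN h1
    have h1 := hcN Mhi hMhi Nhi hNhi
    have h2 := hcN Mhi hMhi Nlo hNlo
    have h3 := hcN Mlo hMlo Nhi hNhi
    have h4 := hcN Mlo hMlo Nlo hNlo
    linarith

/-- The large-`x` facts used by the corners (one existential witness). [folklore] -/
theorem eventually_corners (x₇ B : ℝ) {e : ℝ} (he : 0 < e) :
    ∃ x₀ : ℝ, ∀ x : ℝ, x₀ ≤ x → x₇ ≤ x ∧ Real.exp (Real.exp 1) ≤ x ∧ (2 : ℝ) ^ B ≤ Real.log x ∧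
      26 ≤ Real.log x ∧ 1024 ≤ x ^ e := by
  have hev : ∀ᶠ x : ℝ in Filter.atTop, x₇ ≤ x ∧ Real.exp (Real.exp 1) ≤ x ∧ (2 : ℝ) ^ B ≤ Real.log x ∧
      26 ≤ Real.log x ∧ 1024 ≤ x ^ e := by
    filter_upwards [Filter.eventually_ge_atTop x₇, Filter.eventually_ge_atTop (Real.exp (Real.exp 1)),
      Real.tendsto_log_atTop.eventually_ge_atTop ((2 : ℝ) ^ B),
      Real.tendsto_log_atTop.eventually_ge_atTop 26,
      (tendsto_rpow_atTop he).eventually_ge_atTop 1024] with x h1 h2 h3 h4 h5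
    exact ⟨h1, h2, h3, h4, h5⟩
  obtain ⟨x₀, hx₀⟩ := Filter.eventually_atTop.1 hev
  exact ⟨x₀, hx₀⟩

set_option maxHeartbeats 800000 in -- Theorem 7* with ~50 hypotheses
/-- **The corners of Case II: Theorem 7* in the range (16.2).**  BFI p. 250: "We now apply Theorem 7*
with `M = x^{ν₁}` and `N = x^{ν₂}` … so `L = x/MN ≤ x^{1−2(1−θ₂)/3+2ε}`. We verify the hypotheses (14.5)
and (14.6) as follows: `LR < x^{1−2(1−θ₂)/3+θ₂+3ε} < x^{1/2−ε}` and
`L^{1/2}RM^{−1} < x^{1/2−(1−θ₂)/3+θ₂−(1−θ₂)/3+2ε} < x^{−ε}`; since `θ₂ < 1/10`, the previous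
inequalities hold for sufficiently small `ε`."  Rendered on the exponent scale of the product box
`X' ∈ [x, 2^{15}x]` (`R ≤ X'^θ`, `L₂ ≤ 2X'^ℓ`, `M ≥ X'^{ν₁}`, and the two inequalities
`ℓ + θ < 1/2 − e₀`, `ℓ/2 + θ < ν₁ − e₀` of `BFI.range_theorem7Star_of_two_le` /
`BFI.range_theorem7Star_of_one`): from `BombieriFriedlanderIwaniecTheorem7Star` (with its `ε = e₀/2`,
at `x' = L₂MN ∈ [X', 2^{18}x]`, sifting level `z = exp(√log x) ≤ z₀(x')`) there are `B` (level
exponent) and `C, x₀` with `Δ*(M, N, L₂, Q, R) ≤ C x (log x)^{−A₇}` for `x ≥ x₀`, `QR < xℒ^{−B}`.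
[cite: BombieriFriedlanderIwaniecActa1986, §16 p. 250; §14 (14.5)–(14.6), Theorem 7* p. 246] -/
theorem caseII_corners (h7 : BombieriFriedlanderIwaniecTheorem7Star) {a : ℤ} (ha : a ≠ 0)
    {e₀ : ℝ} (he₀ : 0 < e₀) (he₀' : e₀ ≤ 1) {A₇ : ℝ} (hA₇ : 0 < A₇) :
    ∃ B C x₀ : ℝ, 0 ≤ C ∧ ∀ x : ℝ, x₀ ≤ x → ∀ (X' θ ℓ ν₁ L₂ M N Q R : ℝ),
      x ≤ X' → X' ≤ 2 ^ 15 * x → 1 ≤ Q → 1 ≤ R → R ≤ X' ^ θ → Q * R < x / Real.log x ^ B →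
      1 ≤ L₂ → L₂ ≤ 2 * X' ^ ℓ → X' ^ ν₁ ≤ M → 1 ≤ M → 1 ≤ N →
      X' ≤ L₂ * M * N → L₂ * M * N ≤ 2 ^ 18 * x →
      ℓ + θ < 1 / 2 - e₀ → ℓ / 2 + θ < ν₁ - e₀ →
      deltaStar a (Real.exp (Real.sqrt (Real.log x))) M N L₂ Q R ≤ C * x / Real.log x ^ A₇ := by
  obtain ⟨B₇, C₇, x₇, h7'⟩ := h7 a ha (e₀ / 2) (half_pos he₀) A₇ hA₇
  set B₇' : ℝ := max B₇ 0 with hB₇'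
  have hB₇'0 : 0 ≤ B₇' := le_max_right _ _
  set C₇' : ℝ := max C₇ 0 with hC₇'
  have hC₇'0 : 0 ≤ C₇' := le_max_right _ _
  obtain ⟨x₀, hx₀⟩ := eventually_corners x₇ B₇' (half_pos he₀)
  refine ⟨B₇' + 1, C₇' * 2 ^ 18, x₀, by positivity, ?_⟩
  intro x hx X' θ ℓ ν₁ L₂ M N Q R hxX hX'x hQ1 hR1 hRθ hQR hL₂1 hL2 hMν hM1 hN1 hXlo hXhi h145 h146
  obtain ⟨hx₇, hxee, hLB, hL26, hx16⟩ := hx₀ x hx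
  have hee : (2 : ℝ) < Real.exp (Real.exp 1) := by
    have h1 : (1 : ℝ) < Real.exp 1 := by have := Real.exp_one_gt_d9; linarith
    have h2 : Real.exp 1 < Real.exp (Real.exp 1) := Real.exp_lt_exp.2 h1
    have := Real.exp_one_gt_d9; linarith
  have hx2 : (2 : ℝ) ≤ x := by linarith
  have hx0 : 0 < x := by linarith
  have hx1 : (1 : ℝ) ≤ x := by linarith
  have hX'0 : 0 < X' := by linarith
  have hX'1 : (1 : ℝ) < X' := by linarith
  set L : ℝ := Real.log x with hL
  have hL1 : 1 ≤ L := by linarith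
  have hL0 : 0 < L := by linarith
  set x' : ℝ := L₂ * M * N with hx'
  have hx'x : x ≤ x' := hxX.trans hXlo
  have hx'0 : 0 < x' := by linarith
  have hx'1 : (1 : ℝ) < x' := by linarith
  have hlogx' : Real.log x' ≤ 2 * L := by
    have h1 : Real.log x' ≤ Real.log (2 ^ 18 * x) := Real.log_le_log hx'0 hXhi
    rw [Real.log_mul (by norm_num) hx0.ne', Real.log_pow] at h1
    have h2 : Real.log 2 < 0.6931471808 := Real.log_two_lt_d9
    push_cast at h1
    nlinarith
  have hLx' : L ≤ Real.log x' := Real.log_le_log hx0 hx'x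
  have hLx'1 : 1 ≤ Real.log x' := hL1.trans hLx'
  have hLx'0 : 0 < Real.log x' := by linarith
  -- the level: `QR < x/L^{B₇'+1} ≤ x'/(log x')^{B₇}`
  have hlevel : Q * R < x' / Real.log x' ^ B₇ := by
    have h1 : Real.log x' ^ B₇ ≤ Real.log x' ^ B₇' :=
      Real.rpow_le_rpow_of_exponent_le hLx'1 (le_max_left _ _)
    have h2 : Real.log x' ^ B₇' ≤ (2 * L) ^ B₇' := Real.rpow_le_rpow hLx'0.le hlogx' hB₇'0
    have h3 : (2 * L) ^ B₇' = 2 ^ B₇' * L ^ B₇' := Real.mul_rpow (by norm_num) hL0.le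
    have h4 : 2 ^ B₇' * L ^ B₇' ≤ L ^ (B₇' + 1) := by
      rw [Real.rpow_add hL0, Real.rpow_one, mul_comm]
      exact mul_le_mul_of_nonneg_left hLB (Real.rpow_nonneg hL0.le _)
    have hpos : 0 < Real.log x' ^ B₇ := Real.rpow_pos_of_pos hLx'0 _
    refine hQR.trans_le ?_
    calc x / L ^ (B₇' + 1) ≤ x / Real.log x' ^ B₇ := by
          refine div_le_div_of_nonneg_left hx0.le hpos ?_
          linarith
      _ ≤ x' / Real.log x' ^ B₇ := div_le_div_of_nonneg_right hx'x hpos.le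
  -- `X'^{e₀/2} ≥ 1024`
  have hXe : (1024 : ℝ) ≤ X' ^ (e₀ / 2) := hx16.trans (Real.rpow_le_rpow hx0.le hxX (by linarith))
  -- (14.5): `L₂ R < x'^{1/2 − e₀/2}`
  have h145' : L₂ * R < x' ^ (1 / 2 - e₀ / 2) := by
    have h1 : L₂ * R ≤ 2 * X' ^ (ℓ + θ) := by
      rw [Real.rpow_add hX'0]
      calc L₂ * R ≤ (2 * X' ^ ℓ) * X' ^ θ := mul_le_mul hL2 hRθ (by linarith) (by positivity)
        _ = 2 * (X' ^ ℓ * X' ^ θ) := by ring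
    have h2 : 2 * X' ^ (ℓ + θ) < 2 * X' ^ (1 / 2 - e₀) :=
      mul_lt_mul_of_pos_left (Real.rpow_lt_rpow_of_exponent_lt hX'1 h145) (by norm_num)
    have h3 : 2 * X' ^ (1 / 2 - e₀) ≤ X' ^ (1 / 2 - e₀ / 2) := by
      have : X' ^ (1 / 2 - e₀ / 2) = X' ^ (e₀ / 2) * X' ^ (1 / 2 - e₀) := by
        rw [← Real.rpow_add hX'0]; ring_nf
      rw [this]
      exact mul_le_mul_of_nonneg_right (by linarith) (Real.rpow_nonneg hX'0.le _)
    have h4 : X' ^ (1 / 2 - e₀ / 2) ≤ x' ^ (1 / 2 - e₀ / 2) :=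
      Real.rpow_le_rpow hX'0.le hXlo (by linarith)
    linarith
  -- (14.6): `L₂^{1/2} R < M x'^{−e₀/2}`
  have h146' : L₂ ^ (1 / 2 : ℝ) * R < M * x' ^ (-(e₀ / 2)) := by
    have hL2' : L₂ ^ (1 / 2 : ℝ) ≤ 2 * X' ^ (ℓ / 2) := by
      calc L₂ ^ (1 / 2 : ℝ) ≤ (2 * X' ^ ℓ) ^ (1 / 2 : ℝ) := Real.rpow_le_rpow (by linarith) hL2 (by norm_num)
        _ = 2 ^ (1 / 2 : ℝ) * X' ^ (ℓ / 2) := by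
            rw [Real.mul_rpow (by norm_num) (Real.rpow_nonneg hX'0.le _), ← Real.rpow_mul hX'0.le]
            ring_nf
        _ ≤ 2 * X' ^ (ℓ / 2) := by
            refine mul_le_mul_of_nonneg_right ?_ (Real.rpow_nonneg hX'0.le _)
            calc (2 : ℝ) ^ (1 / 2 : ℝ) ≤ (2 : ℝ) ^ (1 : ℝ) :=
                  Real.rpow_le_rpow_of_exponent_le (by norm_num) (by norm_num)
              _ = 2 := Real.rpow_one 2
    have h1 : L₂ ^ (1 / 2 : ℝ) * R ≤ 2 * X' ^ (ℓ / 2 + θ) := by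
      rw [Real.rpow_add hX'0]
      calc L₂ ^ (1 / 2 : ℝ) * R ≤ (2 * X' ^ (ℓ / 2)) * X' ^ θ :=
            mul_le_mul hL2' hRθ (by linarith) (by positivity)
        _ = 2 * (X' ^ (ℓ / 2) * X' ^ θ) := by ring
    have h2 : 2 * X' ^ (ℓ / 2 + θ) < 2 * X' ^ (ν₁ - e₀) :=
      mul_lt_mul_of_pos_left (Real.rpow_lt_rpow_of_exponent_lt hX'1 h146) (by norm_num)
    -- `x'^{−e₀/2} ≥ (2^18 x)^{−e₀/2} ≥ (2^3 X')^{-e₀/2}·`; we use `x' ≤ 2^18 x ≤ 2^18 X'`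
    have hx'X : x' ≤ 2 ^ 18 * X' := hXhi.trans (by nlinarith)
    have h3 : (2 ^ 18 * X') ^ (-(e₀ / 2)) ≤ x' ^ (-(e₀ / 2)) :=
      Real.rpow_le_rpow_of_nonpos hx'0 hx'X (by linarith)
    have h4 : (2 ^ 18 * X') ^ (-(e₀ / 2)) = ((2 : ℝ) ^ 18) ^ (-(e₀ / 2)) * X' ^ (-(e₀ / 2)) :=
      Real.mul_rpow (by norm_num) hX'0.le
    -- `2 X'^{ν₁ − e₀} ≤ X'^{ν₁} (2^18)^{−e₀/2} X'^{−e₀/2}` iff `2 (2^18)^{e₀/2} ≤ X'^{e₀/2}`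
    have h5 : 2 * X' ^ (ν₁ - e₀) ≤ X' ^ ν₁ * (((2 : ℝ) ^ 18) ^ (-(e₀ / 2)) * X' ^ (-(e₀ / 2))) := by
      have hsplit : X' ^ (ν₁ - e₀) = X' ^ ν₁ * X' ^ (-(e₀ / 2)) * X' ^ (-(e₀ / 2)) := by
        rw [← Real.rpow_add hX'0, ← Real.rpow_add hX'0]; ring_nf
      have h218 : ((2 : ℝ) ^ 18) ^ (-(e₀ / 2)) = (((2 : ℝ) ^ 18) ^ (e₀ / 2))⁻¹ :=
        Real.rpow_neg (by norm_num) _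
      have h218' : ((2 : ℝ) ^ 18) ^ (e₀ / 2) ≤ (2 : ℝ) ^ 9 := by
        calc ((2 : ℝ) ^ 18) ^ (e₀ / 2) ≤ ((2 : ℝ) ^ 18) ^ (1 / 2 : ℝ) :=
              Real.rpow_le_rpow_of_exponent_le (by norm_num) (by linarith)
          _ = 2 ^ 9 := by
              rw [show ((2 : ℝ) ^ 18) = ((2 : ℝ) ^ 9) ^ (2 : ℕ) by norm_num, ← Real.rpow_natCast,
                ← Real.rpow_mul (by norm_num)]
              norm_num
      have hXe' : X' ^ (-(e₀ / 2)) = (X' ^ (e₀ / 2))⁻¹ := Real.rpow_neg hX'0.le _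
      have hp : 0 < X' ^ (e₀ / 2) := by positivity
      have hq : 0 < ((2 : ℝ) ^ 18) ^ (e₀ / 2) := by positivity
      have hkey : 2 * ((2 : ℝ) ^ 18) ^ (e₀ / 2) ≤ X' ^ (e₀ / 2) := by
        have : (2 : ℝ) ^ 9 = 512 := by norm_num
        linarith
      have h2u : 2 * (X' ^ (e₀ / 2))⁻¹ ≤ (((2 : ℝ) ^ 18) ^ (e₀ / 2))⁻¹ := by
        rw [← div_eq_mul_inv, inv_eq_one_div, div_le_div_iff₀ hp hq]
        linarith
      rw [hsplit, h218, hXe']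
      calc 2 * (X' ^ ν₁ * (X' ^ (e₀ / 2))⁻¹ * (X' ^ (e₀ / 2))⁻¹)
          = X' ^ ν₁ * (X' ^ (e₀ / 2))⁻¹ * (2 * (X' ^ (e₀ / 2))⁻¹) := by ring
        _ ≤ X' ^ ν₁ * (X' ^ (e₀ / 2))⁻¹ * (((2 : ℝ) ^ 18) ^ (e₀ / 2))⁻¹ :=
            mul_le_mul_of_nonneg_left h2u (by positivity)
        _ = X' ^ ν₁ * ((((2 : ℝ) ^ 18) ^ (e₀ / 2))⁻¹ * (X' ^ (e₀ / 2))⁻¹) := by ring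
    calc L₂ ^ (1 / 2 : ℝ) * R ≤ 2 * X' ^ (ℓ / 2 + θ) := h1
      _ < 2 * X' ^ (ν₁ - e₀) := h2
      _ ≤ X' ^ ν₁ * (((2 : ℝ) ^ 18) ^ (-(e₀ / 2)) * X' ^ (-(e₀ / 2))) := h5
      _ = X' ^ ν₁ * (2 ^ 18 * X') ^ (-(e₀ / 2)) := by rw [h4]
      _ ≤ M * x' ^ (-(e₀ / 2)) := mul_le_mul hMν h3 (Real.rpow_nonneg (by positivity) _) (by linarith)
  -- the sifting level
  have hz : Real.exp (Real.sqrt (Real.log x)) ≤ Real.exp (Real.log x' / Real.log (Real.log x')) :=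
    exp_sqrt_log_le hxee hx'x
  have h := h7' x' (hx₇.trans hx'x) M N L₂ Q R hM1 hN1 hL₂1 hQ1 hR1 (by rw [hx']) hlevel h145' h146' _ hz
  refine h.trans ?_
  have hpow : Real.log x ^ A₇ ≤ Real.log x' ^ A₇ := Real.rpow_le_rpow hL0.le hLx' hA₇.le
  have h0 : 0 ≤ x' / Real.log x' ^ A₇ := by positivity
  calc C₇ * x' / Real.log x' ^ A₇ = C₇ * (x' / Real.log x' ^ A₇) := by ring
    _ ≤ C₇' * (x' / Real.log x' ^ A₇) := mul_le_mul_of_nonneg_right (le_max_left _ _) h0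
    _ ≤ C₇' * (2 ^ 18 * x / Real.log x ^ A₇) := by
        refine mul_le_mul_of_nonneg_left ?_ hC₇'0
        calc x' / Real.log x' ^ A₇ ≤ x' / Real.log x ^ A₇ :=
              div_le_div_of_nonneg_left hx'0.le (Real.rpow_pos_of_pos hL0 _) hpow
          _ ≤ 2 ^ 18 * x / Real.log x ^ A₇ := div_le_div_of_nonneg_right hXhi (Real.rpow_nonneg hL0.le _)
    _ = C₇' * 2 ^ 18 * x / Real.log x ^ A₇ := by ring

end BFI

end Literature.NumberTheory.Sieve
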